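import Summits.ValiantsHypothesis.ValiantsHypothesis.Theses.ShallowShadows
import Summits.ValiantsHypothesis.ValiantsHypothesis.Theorems.ShadowFormulaTransfer.Negative.FalseWithoutZeroOne
import Literature.Computability.AlgebraicComplexity.CircuitArithmetization

/-!
# Crux `ShadowFormulaTransfer` (stmt-ValiantsHypothesis-17124): the index in the logarithm is load-bearing

Negative lemma for the crux X = `ShadowFormulaTransfer` of route `ShallowShadows` (refuter /
cdisprove, cycle 1; companion of `Negative/FalseWithoutZeroOne.lean` (p152518: 0/1 and VP are
load-bearing) and `Negative/FalseOverCharTwo.lean` (p162074: the field is load-bearing)).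

X bounds the monotone formula size of the shadow of `f_n` by
`2^{deg(f_n)^{1-δ} · (log(n+2))^C + C}`; through `IsVPFamily` (`complexity f_n ≤ n^c + c`) the
factor `(log(n+2))^C` is `polylog(CIRCUIT SIZE)`. This file proves that the "intrinsic" variant,
calibrated instead by the number of variables of `f_n` (`log(#σ n + 2)`), is FALSE modulo the
route's far side `RazWigdersonMatching`, even for 0/1-coefficient VP families:
`shadowFormulaTransfer_false_with_vars_calibration`. Witness: the PADDED PERMANENT — at index `n`
the polynomial `per_m`, `m = (Nat.unpair n).1`, switched on only when `complexity per_m ≤ n` (so the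
family is in VP by fiat, with `m² ≤ n² + 2` variables and degree `≤ n + 1`), which happens at every
index `Nat.pair m t` with `t ≥ complexity per_m`; there the intrinsic bound
`2^{m^{1-δ}(log(m²+2))^C + C}` loses against Raz–Wigderson's `2^{cm}` for the shadow `PM_m`.
Moral (the padding normal form of the crux): X is a statement about circuit size versus degree —
`log L(B g) ≲ deg(g)^{1-δ} · polylog(size g)` for single 0/1 polynomials `g` — and no bound in the
degree and the number of variables alone can hold.
-/

noncomputable section

namespace Summit.ValiantsHypothesis.ValiantsHypothesis.Theorems.ShadowFormulaTransfer.Negative.VarsCalibration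

set_option linter.dupNamespace false

open Literature.Computability.AlgebraicComplexity Literature.Computability.Complexity
open Literature.Barriers.PneNP MvPolynomial Filter
open Summit.ValiantsHypothesis.ValiantsHypothesis.Theses.ShallowShadows

/-! ## §4 Load-bearing: the index inside the logarithm (= circuit size), not the number of variables

X calibrates the polylog factor by the INDEX `n`; through `IsVPFamily` (`complexity f_n ≤ n^c + c`)
this is `polylog(circuit size)`. The "intrinsic" variant calibrated by the number of variables of
`f_n` itself is false modulo RW92, by PADDING the permanent inside VP: circuit size must enter. -/

/-- **Load-bearing (index / circuit size).** X with `log (n + 2)` replaced by `log (#σ n + 2)` is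
FALSE modulo RW92, even for 0/1 VP families. Witness (padded permanent): `σ n = Fin m × Fin m`
with `m = (Nat.unpair n).1`, `f n = per_m` if `complexity per_m ≤ n`, else `0`; this is a VP
family (`complexity f_n ≤ n`, `m² ≤ n²` variables, degree `≤ n`) with 0/1 coefficients, equal to
`per_m` at every index `Nat.pair m t` with `t ≥ complexity per_m`, where the intrinsic bound
`2^{m^{1-δ}(log(m²+2))^C + C}` loses against Raz–Wigderson's `2^{cm}`. So in X the factor
`(log(n+2))^C` is exactly where CIRCUIT SIZE enters; no bound in the degree and the number of
variables alone can hold (padding normal form, Disproof §3.3). [folklore] -/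
theorem shadowFormulaTransfer_false_with_vars_calibration (hRW : RazWigdersonMatching) :
    ¬ ∃ δ : ℝ, 0 < δ ∧ ∃ C : ℕ, ∀ (σ : ℕ → Type) [∀ n, Fintype (σ n)] [∀ n, DecidableEq (σ n)]
      (f : ∀ n, MvPolynomial (σ n) ℂ), IsVPFamily f →
      (∀ (n : ℕ) (m : σ n →₀ ℕ), (f n).coeff m = 0 ∨ (f n).coeff m = 1) →
      ∃ n₀ : ℕ, ∀ n ≥ n₀, (formulaSizeOver monotoneBasis
        (fun a : σ n → Bool => decide (∃ m ∈ (f n).support, ∀ i ∈ m.support, a i = true)) : ℝ)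
        ≤ 2 ^ (((f n).totalDegree : ℝ) ^ (1 - δ) *
          (Real.log ((Fintype.card (σ n) : ℝ) + 2)) ^ C + C) := by
  rintro ⟨δ, hδ, C, hC⟩
  obtain ⟨c, hc, m₀, hm₀⟩ := hRW
  -- the padded permanent family
  let padPer : ∀ n : ℕ, MvPolynomial (Fin (Nat.unpair n).1 × Fin (Nat.unpair n).1) ℂ :=
    fun n => if complexity (perPoly (Fin (Nat.unpair n).1) ℂ) ≤ n
      then perPoly (Fin (Nat.unpair n).1) ℂ else 0
  have hpad_of : ∀ n, complexity (perPoly (Fin (Nat.unpair n).1) ℂ) ≤ n →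
      padPer n = perPoly (Fin (Nat.unpair n).1) ℂ := fun n h => if_pos h
  have hpad_not : ∀ n, ¬ complexity (perPoly (Fin (Nat.unpair n).1) ℂ) ≤ n → padPer n = 0 :=
    fun n h => if_neg h
  have hVP : IsVPFamily padPer := by
    refine ⟨⟨⟨2, fun n => ?_⟩, ⟨1, fun n => ?_⟩⟩, ⟨1, fun n => ?_⟩⟩
    · simp only [Fintype.card_prod, Fintype.card_fin]
      have := Nat.unpair_left_le n
      nlinarith
    · show (padPer n).totalDegree ≤ n ^ 1 + 1
      by_cases h : complexity (perPoly (Fin (Nat.unpair n).1) ℂ) ≤ n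
      · rw [hpad_of n h, totalDegree_perPoly_fin, pow_one]
        have := Nat.unpair_left_le n
        omega
      · rw [hpad_not n h, MvPolynomial.totalDegree_zero, pow_one]
        omega
    · show complexity (padPer n) ≤ n ^ 1 + 1
      by_cases h : complexity (perPoly (Fin (Nat.unpair n).1) ℂ) ≤ n
      · rw [hpad_of n h, pow_one]; omega
      · rw [hpad_not n h, CircuitArith.complexity_zero', pow_one]; omega
  have h01 : ∀ (n : ℕ) (mo : Fin (Nat.unpair n).1 × Fin (Nat.unpair n).1 →₀ ℕ),
      (padPer n).coeff mo = 0 ∨ (padPer n).coeff mo = 1 := by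
    intro n mo
    by_cases h : complexity (perPoly (Fin (Nat.unpair n).1) ℂ) ≤ n
    · rw [hpad_of n h]; exact coeff_perPoly_zeroOne _ mo
    · rw [hpad_not n h]; simp
  obtain ⟨n₀, hn₀⟩ := hC (fun n => Fin (Nat.unpair n).1 × Fin (Nat.unpair n).1) padPer hVP h01
  -- the window, with rate `c / 2^(C+1)` to absorb `log(m² + 2) ≤ 2 log(m + 2)`
  have hc₁pos : 0 < c / 2 ^ (C + 1) := by positivity
  obtain ⟨N, hN⟩ := eventually_atTop.mp ((tendsto_natCast_atTop_atTop (R := ℝ)).eventually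
    (eventually_window δ hδ C (c / 2 ^ (C + 1)) hc₁pos))
  obtain ⟨m, hmm₀, hmN, hm1⟩ : ∃ m : ℕ, m₀ ≤ m ∧ N ≤ m ∧ 1 ≤ m :=
    ⟨max (max m₀ N) 1, (le_max_left _ _).trans (le_max_left _ _),
      (le_max_right _ _).trans (le_max_left _ _), le_max_right _ _⟩
  -- the index: `n = ⟨m, t⟩` with `t ≥ n₀` and `t ≥ complexity per_m`
  obtain ⟨n, hn₀n, hun, hcompl⟩ : ∃ n : ℕ, n₀ ≤ n ∧ (Nat.unpair n).1 = m ∧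
      complexity (perPoly (Fin (Nat.unpair n).1) ℂ) ≤ n := by
    refine ⟨Nat.pair m (max n₀ (complexity (perPoly (Fin m) ℂ))),
      (le_max_left _ _).trans (Nat.right_le_pair _ _), by rw [Nat.unpair_pair], ?_⟩
    rw [Nat.unpair_pair]
    exact (le_max_right _ _).trans (Nat.right_le_pair _ _)
  have hb := hn₀ n hn₀n
  simp only [hpad_of n hcompl, shadow_perPoly, totalDegree_perPoly_fin,
    Fintype.card_prod, Fintype.card_fin, Nat.cast_mul] at hb
  rw [hun] at hb
  -- hb : L(PM_m) ≤ 2 ^ (m^(1-δ) * log (m*m + 2)^C + C); RW: 2^(c m) ≤ L(PM_m)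
  have hr := hm₀ m hmm₀
  have hw := hN m hmN
  have hMpos : (0 : ℝ) < m := by exact_mod_cast hm1
  have hchain := hr.trans hb
  rw [Real.rpow_le_rpow_left_iff (by norm_num : (1 : ℝ) < 2)] at hchain
  -- estimate the intrinsic budget
  have hlog0 : 0 ≤ Real.log ((m : ℝ) * m + 2) := Real.log_nonneg (by nlinarith)
  have hlog : Real.log ((m : ℝ) * m + 2) ≤ 2 * Real.log ((m : ℝ) + 2) := by
    calc Real.log ((m : ℝ) * m + 2) ≤ Real.log (((m : ℝ) + 2) ^ 2) :=
          Real.log_le_log (by nlinarith) (by nlinarith)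
      _ = 2 * Real.log ((m : ℝ) + 2) := by rw [Real.log_pow]; norm_num
  have hpowC : Real.log ((m : ℝ) * m + 2) ^ C ≤ 2 ^ C * Real.log ((m : ℝ) + 2) ^ C := by
    calc _ ≤ (2 * Real.log ((m : ℝ) + 2)) ^ C := pow_le_pow_left₀ hlog0 hlog C
      _ = 2 ^ C * Real.log ((m : ℝ) + 2) ^ C := by rw [mul_pow]
  have hrpow0 : 0 ≤ (m : ℝ) ^ (1 - δ) := (Real.rpow_pos_of_pos hMpos _).le
  have hlogM0 : 0 ≤ Real.log ((m : ℝ) + 2) ^ C := pow_nonneg (Real.log_nonneg (by linarith)) C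
  have h2C : (1 : ℝ) ≤ 2 ^ C := one_le_pow₀ (by norm_num)
  have h1 : (m : ℝ) ^ (1 - δ) * Real.log ((m : ℝ) * m + 2) ^ C
      ≤ 2 ^ C * ((m : ℝ) ^ (1 - δ) * Real.log ((m : ℝ) + 2) ^ C) := by
    calc _ ≤ (m : ℝ) ^ (1 - δ) * (2 ^ C * Real.log ((m : ℝ) + 2) ^ C) :=
          mul_le_mul_of_nonneg_left hpowC hrpow0
      _ = _ := by ring
  have hC0 : (0 : ℝ) ≤ C := Nat.cast_nonneg C
  have h2 : (m : ℝ) ^ (1 - δ) * Real.log ((m : ℝ) * m + 2) ^ C + C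
      ≤ 2 ^ C * ((m : ℝ) ^ (1 - δ) * Real.log ((m : ℝ) + 2) ^ C + C) := by nlinarith
  have h3 : (2 : ℝ) ^ C * (c / 2 ^ (C + 1) * m) = c / 2 * m := by
    rw [pow_succ]; field_simp
  have h4 : (2 : ℝ) ^ C * ((m : ℝ) ^ (1 - δ) * Real.log ((m : ℝ) + 2) ^ C + C) < c / 2 * m := by
    rw [← h3]; exact mul_lt_mul_of_pos_left hw (by positivity)
  nlinarith

end Summit.ValiantsHypothesis.ValiantsHypothesis.Theorems.ShadowFormulaTransfer.Negative.VarsCalibration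

end
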